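/-
Copyright (c) 2026 the pub-hodgecm-mathlib formalisation cell (harness21).  Prover seat hodgecm-mathlib-F0P3a-p06 (g20), line LH3 letter L3′ SURJ-OF-FORWARD road, organ (Σ-LOC)
«localisation on the stable-class space», partition-of-unity half (binder LH10-p01 (g5), LH3-plan (g4) RULINGS #22∕#23); 2026-09-02.
-/
import Mathlib
import HarnessLib

/-!
# Finite smooth partitions of unity subordinate to balls of PRESCRIBED radii on a compact set, and the localisation of a family by smooth cutoffs of a class map
# (Bouaziz 1994 §2.3 Lemme 2.3.1 «partition de l'unité invariante», §5.1 p. 588)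

Topic `Analysis/Calculus`; namespace `Literature.Analysis.Calculus`.  THEOREMS ONLY (no `def`, no instance, no notation, no axiom, no named fact, no `sorry`); Mathlib-only.
Cell `pub/hodgecm-mathlib`, crux H413 = `stmt-HodgeConjecture-24833`; line LH3, letter L3′ (Bouaziz's surjectivity for `H_∞ = U(1,1)^W × U(1)^W`), SURJ-OF-FORWARD assembly
`bouazizSurjOfForward_of_parts : (Σ-LOC) → (Σ-LOCAL) → (Σ-ADD) → …` (LH10-p01 (g5) skeleton v1): this file is the GROUP-FREE core of organ **(Σ-LOC)** — Bouaziz's reduction «si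
`J_G` est surjective sur une famille d'ouverts complètement invariants recouvrant `U` … `J_G(φ₁ + ⋯ + φₙ) = ψ`» (ÉNS 27 §5.1 p. 588) rests on an INVARIANT PARTITION OF UNITY by smooth
functions of the class (Lemme 2.3.1); here the class is read through an arbitrary map `cl : ι → X → E` into a finite-dimensional real normed space `E` (for `H_∞`: the per-place
`(tr, det, u)` data `bzClassMap`), and «invariant smooth function» becomes «`F ∘ cl` with `F ∈ C_c^∞(E)`».

* §1 **`exists_fin_contDiff_tsupport_subset_ball_sum_eq_one`** — for a compact `K ⊆ E` (`E` finite-dimensional) and ANY prescription of positive radii `ε : E → ℝ`, finitely many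
  smooth `F_i : E → ℝ`, `0 ≤ F_i ≤ 1`, compactly supported with `tsupport F_i ⊆ ball b_i (ε b_i)`, `b_i ∈ K`, and `∑ i, F_i = 1` on `K` (Mathlib `SmoothPartitionOfUnity.exists_isSubordinate`
  on the model space `𝓘(ℝ, E)` over a finite subcover of `{ball b (ε b)}_{b ∈ K}`, re-indexed by `Fin n`).
* §2 **`exists_fin_cutoff_localized_sum_eq`** — the LOCALISATION: a predicate `P` on families `Ψ : ι → X → ℂ` that is STABLE UNDER SMOOTH COMPACTLY SUPPORTED CUTOFFS OF THE CLASS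
  (`P Ψ → P (fun S c => F (cl S c) · Ψ S c)`, the (Σ3-core) class-cutoff lemma of the road, taken as a hypothesis) and a member `Ψ` whose non-zero values have classes in a compact
  `K`, split, for any positive radii `ε`, as a finite sum `Ψ = ∑ i, Ψs i` (EVERYWHERE, not only on regular sets) of members `Ψs i` with `P (Ψs i)`, each vanishing at every point
  whose class is `ε(b_i)`-far from its base class `b_i ∈ K` — the text of (Σ-LOC)'s `BzLocalized (Ψs i) (b i) (ε (b i))` with `cl = bzClassMap`; `exists_fin_cutoff_localized_sum_eq'`
  is the same with the cutoff hypothesis asked for ALL smooth `F` (no compact-support clause).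
HONEST LABEL: HC_CM is proved only modulo the 7 printed citations (2 remaining: hLiu418 = `stmt-HodgeConjecture-24832`, h413 = `stmt-HodgeConjecture-24833`) until rung 0 closes;
this file is generic calculus bookkeeping (count-neutral) — Bouaziz's surjectivity (Thm. 6.2.1) is NOT proved here.

## References
* [Bouaziz1994IntegralesOrbitales] A. Bouaziz, *Intégrales orbitales sur les groupes de Lie réductifs*, Ann. Sci. ÉNS (4) 27 (1994) 573–609, §2.3 Lemme 2.3.1, §5.1 p. 588.
* [Varadarajan1989] V. S. Varadarajan, *An Introduction to Harmonic Analysis on Semisimple Lie Groups*, Cambridge Stud. Adv. Math. 16 (1989), §6 p. 229.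
-/

set_option autoImplicit false

noncomputable section

open Set Function Metric
open scoped Manifold ContDiff Topology

namespace Literature.Analysis.Calculus

/-! ## §1 Finite smooth partitions of unity subordinate to balls of prescribed radii -/

section PartitionOfUnity

variable {E : Type*} [NormedAddCommGroup E] [NormedSpace ℝ E] [FiniteDimensional ℝ E]

/-- **FINITE SMOOTH PARTITION OF UNITY ON A COMPACT SET, SUBORDINATE TO BALLS OF PRESCRIBED RADII.**  For a compact `K` in a finite-dimensional real normed space and radii
`ε b > 0` (`b ∈ E`), there are finitely many centres `b_i ∈ K` and smooth functions `F_i : E → ℝ` with `0 ≤ F_i ≤ 1`, `tsupport F_i ⊆ ball b_i (ε b_i)` (so `F_i` is compactly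
supported) and `∑ i, F_i x = 1` for every `x ∈ K`: a finite subcover of `K ⊆ ⋃_{b ∈ K} ball b (ε b)` and Mathlib's `SmoothPartitionOfUnity.exists_isSubordinate` on the model space
`𝓘(ℝ, E)`. [cite: Bouaziz1994IntegralesOrbitales, §2.3 Lemme 2.3.1] -/
theorem exists_fin_contDiff_tsupport_subset_ball_sum_eq_one {K : Set E} (hK : IsCompact K) (ε : E → ℝ) (hε : ∀ b, 0 < ε b) :
    ∃ (n : ℕ) (b : Fin n → E) (F : Fin n → E → ℝ),
      (∀ i, b i ∈ K ∧ ContDiff ℝ ∞ (F i) ∧ HasCompactSupport (F i) ∧ tsupport (F i) ⊆ ball (b i) (ε (b i)) ∧ (∀ x, 0 ≤ F i x) ∧ ∀ x, F i x ≤ 1) ∧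
      ∀ x ∈ K, ∑ i, F i x = 1 := by
  classical
  -- a finite subcover of the cover of `K` by the prescribed balls centred in `K`
  obtain ⟨t, htK, hKt⟩ : ∃ t : Finset E, (↑t : Set E) ⊆ K ∧ K ⊆ ⋃ b ∈ t, ball b (ε b) := by
    obtain ⟨t, ht⟩ := hK.elim_finite_subcover (fun b : K => ball (b : E) (ε b)) (fun _ => isOpen_ball)
      (fun x hx => mem_iUnion.2 ⟨⟨x, hx⟩, mem_ball_self (hε x)⟩)
    refine ⟨t.image (fun b : K => (b : E)), ?_, ?_⟩
    · intro x hx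
      obtain ⟨b, _, rfl⟩ := Finset.mem_image.1 hx
      exact b.2
    · intro x hx
      obtain ⟨b, hb⟩ := mem_iUnion.1 (ht hx)
      obtain ⟨hbt, hxb⟩ := mem_iUnion.1 hb
      exact mem_iUnion₂.2 ⟨(b : E), Finset.mem_image.2 ⟨b, hbt, rfl⟩, hxb⟩
  -- a smooth partition of unity indexed by the subcover
  have hcov : K ⊆ ⋃ i : (↑t : Set E), ball (i : E) (ε i) := by
    intro x hx
    obtain ⟨b, hb⟩ := mem_iUnion.1 (hKt hx)
    obtain ⟨hbt, hxb⟩ := mem_iUnion.1 hb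
    exact mem_iUnion.2 ⟨⟨b, hbt⟩, hxb⟩
  obtain ⟨ρ, hρ⟩ := SmoothPartitionOfUnity.exists_isSubordinate 𝓘(ℝ, E) hK.isClosed (fun i : (↑t : Set E) => ball (i : E) (ε i))
    (fun _ => isOpen_ball) hcov
  have hρs : ∀ i, ContDiff ℝ ∞ (ρ i : E → ℝ) := fun i => contMDiff_iff_contDiff.1 (ρ i).contMDiff
  have hρc : ∀ i, HasCompactSupport (ρ i : E → ℝ) := fun i =>
    isCompact_of_isClosed_isBounded (isClosed_tsupport _) (isBounded_ball.subset (hρ i))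
  -- re-index by `Fin n`
  set e := (Fintype.equivFin (↑t : Set E)).symm with he
  refine ⟨Fintype.card (↑t : Set E), fun j => (e j : E), fun j => (ρ (e j) : E → ℝ), fun j => ⟨htK (e j).2, hρs _, hρc _, hρ (e j), fun x => ρ.nonneg _ x,
    fun x => ρ.le_one _ x⟩, fun x hx => ?_⟩
  have h1 := ρ.sum_eq_one hx
  rw [finsum_eq_sum_of_fintype] at h1
  rw [← h1]
  exact e.sum_comp (fun i => (ρ i : E → ℝ) x)

end PartitionOfUnity

/-! ## §2 Localisation of a family by smooth cutoffs of its class -/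

section Localization

variable {E : Type*} [NormedAddCommGroup E] [NormedSpace ℝ E] [FiniteDimensional ℝ E] {ι X : Type*}

/-- **LOCALISATION BY SMOOTH CLASS CUTOFFS (compactly supported cutoffs).**  Let `cl : ι → X → E` be a «class map» into a finite-dimensional real normed space and `P` a predicate on
families `Ψ : ι → X → ℂ` stable under smooth compactly supported cutoffs of the class (`P Ψ → P (fun S c => F (cl S c) · Ψ S c)`).  If `P Ψ` and the classes of the points where `Ψ`
does not vanish lie in a compact `K`, then for every prescription of positive radii `ε` there are finitely many base classes `b_i ∈ K` and families `Ψs i` with `P (Ψs i)`, each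
vanishing wherever the class is `ε(b_i)`-far from `b_i`, and `Ψ S c = ∑ i, Ψs i S c` for ALL `S, c` (`Ψs i = (F_i ∘ cl) · Ψ` for the partition of unity of §1; off `K` both sides
vanish). [cite: Bouaziz1994IntegralesOrbitales, §2.3 Lemme 2.3.1; §5.1 p. 588] -/
theorem exists_fin_cutoff_localized_sum_eq (cl : ι → X → E) (P : (ι → X → ℂ) → Prop)
    (hcut : ∀ F : E → ℝ, ContDiff ℝ ∞ F → HasCompactSupport F → ∀ Ψ : ι → X → ℂ, P Ψ → P (fun S c => (F (cl S c) : ℂ) * Ψ S c))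
    {Ψ : ι → X → ℂ} (hΨ : P Ψ) {K : Set E} (hK : IsCompact K) (hsupp : ∀ S c, Ψ S c ≠ 0 → cl S c ∈ K) (ε : E → ℝ) (hε : ∀ b, 0 < ε b) :
    ∃ (n : ℕ) (b : Fin n → E) (Ψs : Fin n → ι → X → ℂ),
      (∀ i, b i ∈ K ∧ P (Ψs i) ∧ ∀ S c, ε (b i) ≤ dist (cl S c) (b i) → Ψs i S c = 0) ∧ ∀ S c, Ψ S c = ∑ i, Ψs i S c := by
  obtain ⟨n, b, F, hF, hsum⟩ := exists_fin_contDiff_tsupport_subset_ball_sum_eq_one hK ε hε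
  refine ⟨n, b, fun i S c => (F i (cl S c) : ℂ) * Ψ S c, fun i => ⟨(hF i).1, hcut (F i) (hF i).2.1 (hF i).2.2.1 Ψ hΨ, fun S c hfar => ?_⟩, fun S c => ?_⟩
  · -- the class is outside the ball carrying `tsupport F_i`
    have hnot : cl S c ∉ tsupport (F i) := fun h => by
      have hb := (hF i).2.2.2.1 h
      rw [mem_ball] at hb
      exact absurd hb (not_lt.2 hfar)
    show (F i (cl S c) : ℂ) * Ψ S c = 0
    rw [image_eq_zero_of_notMem_tsupport hnot, Complex.ofReal_zero, zero_mul]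
  · show Ψ S c = ∑ i, (F i (cl S c) : ℂ) * Ψ S c
    by_cases h0 : Ψ S c = 0
    · simp only [h0, mul_zero, Finset.sum_const_zero]
    · rw [← Finset.sum_mul, ← Complex.ofReal_sum, hsum (cl S c) (hsupp S c h0), Complex.ofReal_one, one_mul]

/-- **LOCALISATION BY SMOOTH CLASS CUTOFFS** — the same with the cutoff-stability hypothesis asked for every smooth `F` (no compact-support clause).
[cite: Bouaziz1994IntegralesOrbitales, §2.3 Lemme 2.3.1; §5.1 p. 588] -/
theorem exists_fin_cutoff_localized_sum_eq' (cl : ι → X → E) (P : (ι → X → ℂ) → Prop)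
    (hcut : ∀ F : E → ℝ, ContDiff ℝ ∞ F → ∀ Ψ : ι → X → ℂ, P Ψ → P (fun S c => (F (cl S c) : ℂ) * Ψ S c))
    {Ψ : ι → X → ℂ} (hΨ : P Ψ) {K : Set E} (hK : IsCompact K) (hsupp : ∀ S c, Ψ S c ≠ 0 → cl S c ∈ K) (ε : E → ℝ) (hε : ∀ b, 0 < ε b) :
    ∃ (n : ℕ) (b : Fin n → E) (Ψs : Fin n → ι → X → ℂ),
      (∀ i, b i ∈ K ∧ P (Ψs i) ∧ ∀ S c, ε (b i) ≤ dist (cl S c) (b i) → Ψs i S c = 0) ∧ ∀ S c, Ψ S c = ∑ i, Ψs i S c :=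
  exists_fin_cutoff_localized_sum_eq cl P (fun F hF _ => hcut F hF) hΨ hK hsupp ε hε

end Localization

end Literature.Analysis.Calculus

end
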